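/-
Copyright (c) 2026 the pub-hodgecm-mathlib formalisation cell (harness21).  Prover seat hodgecm-mathlib-K2Liu-p13 (g4), Track B «K2-LIT»,
#184♮ = hLiu418 = `stmt-HodgeConjecture-24832`; ROAD Φ (RULING «M-156n»), #41 TOP — brick (E7′) of the (β) census `CENSUS-Beta-EulerFace.K2Liu-p13-g4.md`: at the places
where `χ_{F,v}` is RAMIFIED (the `ε_{L∕L⁺}`-ramified places `v ∈ S_ε` of the TOP's exceptional set) the `n = 2` Siegel normaliser `aNorm 2 χ_v vol` of ★ A7 is
`vol · L_{E∕F}(2s, χ_F∘N) ∕ L_{E∕F}(2s+1, χ_F∘N)` and is HOLOMORPHIC on `{0 < re s}` — the letter `hc` of ★ `K2LiuBigCellContinuationOfFaces.exists_bigCell_continuation_cm_of_faces`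
at those places (no value needed there: the TOP's scalar `b^{S_ε}∕a^{S_ε}` carries no `v`-factor to cancel).
THEOREMS ONLY (no `def`, no `instance`, no named-fact hypothesis, no `sorry`).
-/
import Summits.HodgeConjecture.HodgeConjecture.Theorems.K2LiuA7NormaliserAlgebra                  -- ★ `aNum_two`, `bDen_two`, `lEN_ne_zero` (+ ★ `K2LiuQRationalLFactor`)
import Summits.HodgeConjecture.HodgeConjecture.Theorems.K2LiuBigCellContinuationPointLetters       -- ★ p861729 `differentiableOn_re_pos_of_forall_isQRationalRegularAt`
import Summits.HodgeConjecture.HodgeConjecture.Theorems.K2LiuA7ValueSocketHu                       -- ★ σ-9 `isUnramifiedChar_localComponent_iff`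
import Summits.HodgeConjecture.HodgeConjecture.Theorems.K2E1HeckeCharBaseChangeLocalComponentsU    -- ★ J1a-dict `localComponent_eq_prod_of_comp_ideleBaseChange`
import HarnessLib

/-!
# Crux `HLiu418`, ROAD Φ, organ Φ8 (row G6), brick (E7′): THE `n = 2` SIEGEL NORMALISER AT A `χ_F`-RAMIFIED PLACE IS HOLOMORPHIC ON `{0 < re}`

Cell `hodgecm-mathlib`, crux item hLiu418 = `stmt-HodgeConjecture-24832` (helper lane, count-neutral).  Quadratic `E∕F`, involution `c`, finite place `v` of `F`, unitary local
characters `χ_w` (`w ∣ v`) whose restriction `χ_{F,v} = ∏_w χ_w ∘ ι_w` (★ `chiF`) is RAMIFIED.  Then the dead-factor convention of ★ T1 (`L_F(z, χ_F) = 1`) collapses ★ `aNorm_two`: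
* §1 **`aNorm_two_eq_of_not_isUnramifiedChar`** — `aNorm 2 χ_v vol s = vol · lEN(2s) ∕ lEN(2s+1)` (`L_{E∕F}(z, χ_F∘N) = ∏_{w∣v} L_{E_w}(z, χ_w·(χ_{cw}∘c_w))`, ★ `lEN`) for EVERY `s`;
* §2 **`isQRationalRegularAt_aNorm_two_of_not_isUnramifiedChar`** (`0 < re s₀`; ★ `isQRationalRegularAt_lEN_affine`, ★ `lEN_ne_zero`) and
  **`differentiableOn_aNorm_two_of_not_isUnramifiedChar`** — `s ↦ aNorm 2 χ_v vol s` is holomorphic on `{0 < re}` (bridge ★ p861729);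
* §3 THE K2_Liu FRAME **`differentiableOn_aNorm_two_localComponent_cm_of_ramified`** — for a Hecke character `χ` of the CM field `L` with `χ(a_L) = ε(a)` on `𝕀_{L⁺}`
  (`ε = quadraticHeckeCharCM L`, ★ J1a-dict's shape) and a place `v` where `ε` is RAMIFIED: `χ_{F,v} = ε_v` (★ `localComponent_eq_prod_of_comp_ideleBaseChange` + ★ `chiF_apply`)
  is ramified (★ `isUnramifiedChar_localComponent_iff`), so `s ↦ aNorm 2 (χ_w)_{w∣v} vol s` is holomorphic on `{0 < re}` for unitary `χ`.
With ★∕📤 (E7) `K2LiuSiegelNormaliserTwoValue` (unramified `v`: `aNorm 2 = vol·c_v`) this covers the scalar `c κ v` of ★ `exists_bigCell_continuation_cm_of_faces` at every place of the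
TOP's exceptional set `S_ε` (here) and at the good and the `χ`-unramified bad places (there); still open (E7″): `χ_w` ramified above an `ε`-unramified `v`.
Sources: [HarrisKudlaSweet1996, §6 (6.14)–(6.16)]; [KudlaSweet1997, §1]; [Tate1950, §2.5]; [CasselsFrohlichANT1967, Ch. VII §4.3].
HONEST LABEL.  Helper lemmas, count-neutral; `HC_CM` is proved only modulo the 7 printed citations (2 remaining named inputs:
hLiu418 = `stmt-HodgeConjecture-24832`, h413 = `stmt-HodgeConjecture-24833`) until rung 0 closes.
-/

set_option autoImplicit false
-- the mandated namespace repeats the single-problem summit's segment (`HodgeConjecture.HodgeConjecture`)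
set_option linter.dupNamespace false

noncomputable section

open NumberField IsDedekindDomain
open Literature.NumberTheory.GaloisRepresentations Literature.NumberTheory.GaloisRepresentations.IsNonarchimedeanLocalField
open Literature.NumberTheory.Automorphic Literature.NumberTheory.Automorphic.UnitaryGroup
open Summit.HodgeConjecture.HodgeConjecture.Cruxes.HLiu418.K2LiuQRationalDefs
open Summit.HodgeConjecture.HodgeConjecture.Cruxes.HLiu418.K2LiuLocalLFactorDefs
open Summit.HodgeConjecture.HodgeConjecture.Cruxes.HLiu418.K2LiuQRationalLFactor
open Summit.HodgeConjecture.HodgeConjecture.Cruxes.HLiu418.K2LiuA7NormaliserAlgebra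
open Summit.HodgeConjecture.HodgeConjecture.Cruxes.HLiu418.K2LiuBigCellContinuationPointLetters (differentiableOn_re_pos_of_forall_isQRationalRegularAt)
open Summit.HodgeConjecture.HodgeConjecture.Cruxes.HLiu418.K2LiuA7ValueSocketHu (isUnramifiedChar_localComponent_iff)
open Summit.HodgeConjecture.HodgeConjecture.Cruxes.H413.K2E1HeckeCharBaseChangeLocalComponentsU (localComponent_eq_prod_of_comp_ideleBaseChange)

namespace Summit.HodgeConjecture.HodgeConjecture.Cruxes.HLiu418.K2LiuSiegelNormaliserTwoRamified

section Quadratic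

variable (F : Type) [Field F] [NumberField F] (E : Type) [Field E] [NumberField E] [Algebra F E]
  (c : E ≃ₐ[F] E) (v : HeightOneSpectrum (𝓞 F))

/-! ## §1 The dead `L_F`-factors collapse the normaliser -/

/-- **`χ_{F,v}` RAMIFIED ⟹ `aNorm 2 χ_v vol s = vol · L_{E∕F}(2s, χ_F∘N) ∕ L_{E∕F}(2s+1, χ_F∘N)`** for every `s` (`L_F(z, χ_F) = 1`, ★ `lFactor_of_not`; ★ `aNum_two`, ★ `bDen_two`).
[cite: HarrisKudlaSweet1996, §6 (6.16)] [cite: Tate1950, §2.5] -/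
theorem aNorm_two_eq_of_not_isUnramifiedChar {χv : ∀ w : PlacesOver E v, (w.1.adicCompletion E)ˣ →* ℂˣ}
    (hram : ¬ IsUnramifiedChar (chiF F E v χv)) (vol : ℝ) (s : ℂ) :
    aNorm F E c v 2 χv vol s = (vol : ℂ) * (lEN F E c v χv (2 * s) / lEN F E c v χv (2 * s + 1)) := by
  rw [aNorm_def, aNum_two, bDen_two]
  simp only [lF, lFactor_of_not F v hram, one_mul, div_one]

/-! ## §2 Regularity and holomorphy on `{0 < re}` -/

/-- **`χ_{F,v}` RAMIFIED, `χ_v` unitary ⟹ `s ↦ aNorm 2 χ_v vol s` is `q_v`-rational regular at every `s₀` with `0 < re s₀`** (★ `isQRationalRegularAt_lEN_affine` at `2s`, `2s+1`;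
`L_{E∕F}(2s₀+1, χ_F∘N) ≠ 0` ★ `lEN_ne_zero`). [cite: KudlaSweet1997, §1] [cite: HarrisKudlaSweet1996, §6 (6.16)] -/
theorem isQRationalRegularAt_aNorm_two_of_not_isUnramifiedChar {χv : ∀ w : PlacesOver E v, (w.1.adicCompletion E)ˣ →* ℂˣ}
    (hχ : ∀ (w : PlacesOver E v) (x : (w.1.adicCompletion E)ˣ), ‖((χv w x : ℂˣ) : ℂ)‖ = 1)
    (hram : ¬ IsUnramifiedChar (chiF F E v χv)) (vol : ℝ) {s₀ : ℂ} (hs₀ : 0 < s₀.re) :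
    IsQRationalRegularAt (residueFieldCard (v.adicCompletion F)) s₀ (aNorm F E c v 2 χv vol) := by
  have h2 : 0 < ((2 : ℕ) * s₀ + 0 : ℂ).re := by simp [Complex.mul_re]; linarith
  have h3 : 0 < ((2 : ℕ) * s₀ + 1 : ℂ).re := by simp [Complex.mul_re]; linarith
  have hnum := isQRationalRegularAt_lEN_affine c hχ 2 0 h2
  have hden := isQRationalRegularAt_lEN_affine c hχ 2 1 h3
  have hne : lEN F E c v χv ((2 : ℕ) * s₀ + 1) ≠ 0 := lEN_ne_zero c χv hχ h3
  refine (((hnum.div hden hne).const_mul (vol : ℂ)).congr fun s => ?_)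
  rw [aNorm_two_eq_of_not_isUnramifiedChar F E c v hram vol s]
  simp only [Nat.cast_ofNat, add_zero]

/-- **`χ_{F,v}` RAMIFIED, `χ_v` unitary ⟹ `s ↦ aNorm 2 χ_v vol s` is HOLOMORPHIC on `{0 < re}`** (★ p861729 bridge). [cite: KudlaSweet1997, §1] [cite: HarrisKudlaSweet1996, §6 (6.16)] -/
theorem differentiableOn_aNorm_two_of_not_isUnramifiedChar {χv : ∀ w : PlacesOver E v, (w.1.adicCompletion E)ˣ →* ℂˣ}
    (hχ : ∀ (w : PlacesOver E v) (x : (w.1.adicCompletion E)ˣ), ‖((χv w x : ℂˣ) : ℂ)‖ = 1)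
    (hram : ¬ IsUnramifiedChar (chiF F E v χv)) (vol : ℝ) :
    DifferentiableOn ℂ (aNorm F E c v 2 χv vol) {s : ℂ | 0 < s.re} :=
  differentiableOn_re_pos_of_forall_isQRationalRegularAt (lt_trans zero_lt_one (one_lt_residueFieldCard (v.adicCompletion F))).ne'
    fun _ hs₀ => isQRationalRegularAt_aNorm_two_of_not_isUnramifiedChar F E c v hχ hram vol hs₀

end Quadratic

/-! ## §3 The K2_Liu frame: the `ε_{L∕L⁺}`-ramified places -/

section CM

variable (L : Type) [Field L] [NumberField L] [IsCMField L] (v : HeightOneSpectrum (𝓞 ↥(maximalRealSubfield L)))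

omit [IsCMField L] in
/-- **`χ_{F,v}((χ_w)_{w∣v}) = ε_v`** for a Hecke character `χ` of `L` with `χ(a_L) = ε(a)` on `𝕀_{L⁺}` — at EVERY finite place `v` (★ J1a-dict `localComponent_eq_prod_of_comp_ideleBaseChange`
read through ★ `chiF_apply`). [cite: CasselsFrohlichANT1967, Ch. VII §4.3] [cite: HarrisKudlaSweet1996, §6 (6.14)] -/
theorem chiF_localComponent_eq (χ : HeckeCharacter L) (ε : HeckeCharacter ↥(maximalRealSubfield L))
    (hχε : ∀ a : ideleGroup ↥(maximalRealSubfield L), χ (AdeleRing.ideleBaseChange ↥(maximalRealSubfield L) L a) = ε a) :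
    chiF ↥(maximalRealSubfield L) L v (fun w : PlacesOver L v => χ.localComponent w.1) = ε.localComponent v :=
  MonoidHom.ext fun u => by rw [chiF_apply, localComponent_eq_prod_of_comp_ideleBaseChange χ ε hχε v u]

/-- **AT AN `ε_{L∕L⁺}`-RAMIFIED PLACE the `n = 2` normaliser of the local components of a unitary Hecke character `χ` of `L` with `χ|_{𝕀_{L⁺}} = ε_{L∕L⁺}` is HOLOMORPHIC on
`{0 < re}`** — the letter `hc` of ★ `exists_bigCell_continuation_cm_of_faces` at `v ∈ S_ε`. [cite: KudlaSweet1997, §1] [cite: HarrisKudlaSweet1996, §6 (6.14)–(6.16)] -/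
theorem differentiableOn_aNorm_two_localComponent_cm_of_ramified (χ : HeckeCharacter L)
    (hχε : ∀ a : ideleGroup ↥(maximalRealSubfield L), χ (AdeleRing.ideleBaseChange ↥(maximalRealSubfield L) L a) = quadraticHeckeCharCM L a)
    (hχu : ∀ (w : PlacesOver L v) (x : (w.1.adicCompletion L)ˣ), ‖((χ.localComponent w.1 x : ℂˣ) : ℂ)‖ = 1)
    (hram : ¬ (quadraticHeckeCharCM L).IsUnramifiedAt v) (vol : ℝ) :
    DifferentiableOn ℂ (aNorm ↥(maximalRealSubfield L) L (IsCMField.complexConj L : L ≃ₐ[↥(maximalRealSubfield L)] L) v 2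
      (fun w : PlacesOver L v => χ.localComponent w.1) vol) {s : ℂ | 0 < s.re} := by
  refine differentiableOn_aNorm_two_of_not_isUnramifiedChar ↥(maximalRealSubfield L) L (IsCMField.complexConj L) v hχu ?_ vol
  rw [chiF_localComponent_eq L v χ (quadraticHeckeCharCM L) hχε, isUnramifiedChar_localComponent_iff L v]
  exact hram

end CM

end Summit.HodgeConjecture.HodgeConjecture.Cruxes.HLiu418.K2LiuSiegelNormaliserTwoRamified

end
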